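import Mathlib
import HarnessLib
import Literature.NumberTheory.LFunctions.RHWave0PNTProofs

/-!
# `DilatedChowla` (stmt-Parity-13319): prime-counting input for the pretender obstruction

Companion (cdisprove seat) of `DilatedChowlaPretender`: the two analytic inputs that turn the
pretender construction (`pretender_failure`: a completely multiplicative `f = λ` on all primes
`≤ 2M+1` with `|Σ_{m∈(M,2M]} f(m+1)f(2m+1)| ≥ π(4M+1) − π(2M+1)`) into the refutation of the crux's
inequality for pretenders (`DilatedChowlaPretenderFalse`).  Both are independent of the crux:

* `primeCounting_window_ge` — from the prime number theorem (tree, PROVED: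
  `Literature.NumberTheory.LFunctions.primeCounting_isEquivalent_holds`, `π(x) ~ x/log x`):
  `π(4M+1) − π(2M+1) ≥ M / log(2M+1)` for all large `M` (PNT with `ε = 1/10` at `x = 4M+1` and
  `x = 2M+1`, and `log(4M+1) ≤ (11/10) log(2M+1)` for `M ≥ 512`).
* `eventually_trivial_gt_log` — the archimedean step with a logarithm: for `κ > 0` and any `C`,
  eventually `C · M^{1−κ} · log(2M+1) < M`.

No cited facts; the PNT used is a proved tree theorem. [folklore]
-/

noncomputable section

namespace Summit.Parity.GeneralizedHardyLittlewood.Theorems.DilatedChowla.Negative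

open Finset Filter Asymptotics

/-- **Primes in the window `(2M+1, 4M+1]` (prime number theorem).** For all large `M`,
`M / log(2M+1) ≤ π(4M+1) − π(2M+1)` (as real numbers). -/
theorem primeCounting_window_ge :
    ∃ M₀ : ℕ, ∀ M : ℕ, M₀ ≤ M → (M : ℝ) / Real.log (2 * M + 1) ≤
      (Nat.primeCounting (4 * M + 1) : ℝ) - Nat.primeCounting (2 * M + 1) := by
  have hPNT := Literature.NumberTheory.LFunctions.primeCounting_isEquivalent_holds
  have hev := hPNT.isLittleO.def (by norm_num : (0 : ℝ) < 1 / 10)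
  rw [eventually_atTop] at hev
  obtain ⟨x₀, hx₀⟩ := hev
  obtain ⟨M₁, hM₁⟩ := exists_nat_ge x₀
  refine ⟨max M₁ 512, fun M hM => ?_⟩
  have hM1 : M₁ ≤ M := le_trans (le_max_left _ _) hM
  have hM512 : 512 ≤ M := le_trans (le_max_right _ _) hM
  have hMr : (512 : ℝ) ≤ M := by exact_mod_cast hM512
  -- the two PNT instances
  have key : ∀ N : ℕ, M₁ ≤ N → 1 ≤ N →
      |(Nat.primeCounting N : ℝ) - N / Real.log N| ≤ 1 / 10 * (N / Real.log N) := by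
    intro N hN hN1
    have hxN : x₀ ≤ (N : ℝ) := le_trans hM₁ (by exact_mod_cast hN)
    have h := hx₀ (N : ℝ) hxN
    have hN1' : (1 : ℝ) ≤ N := by exact_mod_cast hN1
    simp only [Pi.sub_apply, Nat.floor_natCast, Real.norm_eq_abs] at h
    rwa [abs_of_nonneg (div_nonneg (Nat.cast_nonneg N) (Real.log_nonneg hN1'))] at h
  have hA := key (4 * M + 1) (by omega) (by omega)
  have hB := key (2 * M + 1) (by omega) (by omega)
  push_cast at hA hB
  have hLb : 0 < Real.log (2 * (M : ℝ) + 1) := Real.log_pos (by linarith)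
  have hLa : 0 < Real.log (4 * (M : ℝ) + 1) := Real.log_pos (by linarith)
  -- `log(4M+1) ≤ log 2 + log(2M+1) ≤ (11/10) log(2M+1)` (as `2M+1 ≥ 1025 ≥ 2^10`)
  have hlog2 : Real.log 2 ≤ (1 / 10) * Real.log (2 * (M : ℝ) + 1) := by
    have h1024 : Real.log ((2 : ℝ) ^ (10 : ℕ)) ≤ Real.log (2 * (M : ℝ) + 1) :=
      Real.log_le_log (by positivity) (by norm_num; linarith)
    rw [Real.log_pow] at h1024
    push_cast at h1024
    linarith
  have hLab : Real.log (4 * (M : ℝ) + 1) ≤ (11 / 10) * Real.log (2 * (M : ℝ) + 1) := by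
    have h := Real.log_le_log (by linarith : (0 : ℝ) < 4 * M + 1)
      (by linarith : (4 * (M : ℝ) + 1) ≤ 2 * (2 * M + 1))
    rw [Real.log_mul (by norm_num) (by positivity)] at h
    linarith
  -- lower bound for `π(4M+1)`, upper bound for `π(2M+1)`
  have hπa : (9 / 10) * ((4 * (M : ℝ) + 1) / Real.log (4 * (M : ℝ) + 1)) ≤
      (Nat.primeCounting (4 * M + 1) : ℝ) := by
    have := (abs_le.mp hA).1; linarith
  have hπb : (Nat.primeCounting (2 * M + 1) : ℝ) ≤
      (11 / 10) * ((2 * (M : ℝ) + 1) / Real.log (2 * (M : ℝ) + 1)) := by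
    have := (abs_le.mp hB).2; linarith
  have hdiv : (4 * (M : ℝ) + 1) / ((11 / 10) * Real.log (2 * (M : ℝ) + 1)) ≤
      (4 * (M : ℝ) + 1) / Real.log (4 * (M : ℝ) + 1) :=
    div_le_div_of_nonneg_left (by linarith) hLa hLab
  -- elementary assembly: `M ≤ (9/11)(4M+1) − (11/10)(2M+1)` for `M ≥ 4`
  have hX : (9 / 10) * ((4 * (M : ℝ) + 1) / ((11 / 10) * Real.log (2 * (M : ℝ) + 1))) =
      ((9 / 11) * (4 * (M : ℝ) + 1)) / Real.log (2 * (M : ℝ) + 1) := by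
    field_simp
  have hgoal : (M : ℝ) / Real.log (2 * (M : ℝ) + 1) ≤
      (9 / 10) * ((4 * (M : ℝ) + 1) / ((11 / 10) * Real.log (2 * (M : ℝ) + 1))) -
        (11 / 10) * ((2 * (M : ℝ) + 1) / Real.log (2 * (M : ℝ) + 1)) := by
    rw [hX, mul_div_assoc', ← sub_div, div_le_div_iff_of_pos_right hLb]
    linarith
  linarith [mul_le_mul_of_nonneg_left hdiv (by norm_num : (0 : ℝ) ≤ 9 / 10)]

/-- Archimedean step with a logarithm: for `κ > 0` and any `C`, eventually
`C · M^{1−κ} · log(2M+1) < M`. -/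
theorem eventually_trivial_gt_log {κ : ℝ} (hκ : 0 < κ) (C : ℝ) :
    ∀ᶠ M : ℕ in atTop, C * (M : ℝ) ^ (1 - κ) * Real.log (2 * M + 1) < M := by
  -- `log x ≤ x^{κ/2}` and `3 C' 3^{κ/2} < x^{κ/2}` eventually, with `C' = max C 1 > 0`
  have hC'1 : (1 : ℝ) ≤ max C 1 := le_max_right _ _
  have hC'0 : (0 : ℝ) ≤ max C 1 := le_trans zero_le_one hC'1
  have hκ2 : 0 < κ / 2 := by linarith
  have hlog : ∀ᶠ x : ℝ in atTop, Real.log x ≤ x ^ (κ / 2) := by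
    have h := (isLittleO_log_rpow_atTop hκ2).def zero_lt_one
    filter_upwards [h, eventually_ge_atTop (1 : ℝ)] with x hx hx1
    rw [one_mul, Real.norm_eq_abs, Real.norm_eq_abs, abs_of_nonneg (Real.log_nonneg hx1),
      abs_of_nonneg (Real.rpow_nonneg (by linarith) _)] at hx
    exact hx
  have hpow : Tendsto (fun x : ℝ => x ^ (κ / 2)) atTop atTop := tendsto_rpow_atTop hκ2
  have h3 : ∀ᶠ x : ℝ in atTop, 3 * max C 1 * (3 : ℝ) ^ (κ / 2) < x ^ (κ / 2) :=
    hpow.eventually_gt_atTop _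
  have hnat : Tendsto (fun M : ℕ => (2 * (M : ℝ) + 1)) atTop atTop := by
    apply tendsto_atTop_add_const_right
    exact Tendsto.const_mul_atTop zero_lt_two tendsto_natCast_atTop_atTop
  filter_upwards [hnat.eventually hlog, tendsto_natCast_atTop_atTop.eventually h3,
    eventually_ge_atTop 1] with M hM h3M hM1
  have hx : (1 : ℝ) ≤ M := by exact_mod_cast hM1
  have hx0 : (0 : ℝ) < M := by linarith
  -- `log(2M+1) ≤ (2M+1)^{κ/2} ≤ (3M)^{κ/2} = 3^{κ/2} M^{κ/2}`
  have hlog3 : Real.log (2 * M + 1) ≤ (3 : ℝ) ^ (κ / 2) * (M : ℝ) ^ (κ / 2) := by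
    refine le_trans hM ?_
    rw [← Real.mul_rpow (by norm_num) hx0.le]
    exact Real.rpow_le_rpow (by linarith) (by linarith) hκ2.le
  have hpos1 : 0 ≤ (M : ℝ) ^ (1 - κ) := Real.rpow_nonneg hx0.le _
  have hlogpos : 0 ≤ Real.log (2 * M + 1) := Real.log_nonneg (by linarith)
  have hprod : (M : ℝ) ^ (1 - κ) * (M : ℝ) ^ (κ / 2) = (M : ℝ) ^ (1 - κ / 2) := by
    rw [← Real.rpow_add hx0]; congr 1; ring
  have hprod' : (M : ℝ) ^ (κ / 2) * (M : ℝ) ^ (1 - κ / 2) = M := by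
    rw [← Real.rpow_add hx0, show κ / 2 + (1 - κ / 2) = (1 : ℝ) by ring, Real.rpow_one]
  have hkey : max C 1 * (3 : ℝ) ^ (κ / 2) < (M : ℝ) ^ (κ / 2) / 3 := by
    rw [lt_div_iff₀ (by norm_num : (0 : ℝ) < 3)]
    linarith
  calc C * (M : ℝ) ^ (1 - κ) * Real.log (2 * M + 1)
      ≤ max C 1 * (M : ℝ) ^ (1 - κ) * Real.log (2 * M + 1) := by
        gcongr
        exact le_max_left _ _
    _ ≤ max C 1 * (M : ℝ) ^ (1 - κ) * ((3 : ℝ) ^ (κ / 2) * (M : ℝ) ^ (κ / 2)) := by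
        gcongr
    _ = (max C 1 * (3 : ℝ) ^ (κ / 2)) * ((M : ℝ) ^ (1 - κ) * (M : ℝ) ^ (κ / 2)) := by ring
    _ = (max C 1 * (3 : ℝ) ^ (κ / 2)) * (M : ℝ) ^ (1 - κ / 2) := by rw [hprod]
    _ < ((M : ℝ) ^ (κ / 2) / 3) * (M : ℝ) ^ (1 - κ / 2) :=
        mul_lt_mul_of_pos_right hkey (Real.rpow_pos_of_pos hx0 _)
    _ = M / 3 := by rw [div_mul_eq_mul_div, hprod']
    _ ≤ M := by linarith

end Summit.Parity.GeneralizedHardyLittlewood.Theorems.DilatedChowla.Negative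

end
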